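import Literature.NumberTheory.Transcendental.CyclotomicSimplexRep
import Mathlib.LinearAlgebra.Finsupp.LinearCombination
import Mathlib.LinearAlgebra.Span.Basic
import HarnessLib
import Summits.KontsevichZagierPeriods.KontsevichZagierPeriods.Theorems.OctahedralSymmetryOctahedralSpanAllWeightsDefs
import Summits.KontsevichZagierPeriods.KontsevichZagierPeriods.Theorems.FurushoPentagonDoubleShuffleOfPentagon

/-!
# Crux `OctahedralSpanAllWeights` (stmt-KontsevichZagierPeriods-9659), line `Sketch`: block E2 — tools and glue

Helper file for the unit-pole filtration argument of the line `Sketch` for the crux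
`OctaSpan.OctahedralSpanAllWeights` (route `OctahedralSymmetry`, problem `KontsevichZagierPeriods`).
Block **E2** of the skeleton: a convergent level-4 word `W` with `1 ≤ #0(W) ≤ #4(W)` (letter `0` =
pole `1`, letter `4` = pole `0`) lies, modulo `rel`, in `lowerSpan W` (convergent words of the same
length with fewer letters `0`).  No all-weights proof of E2 is known; this file proves its UNIFORM
part — the reduction of E2 (indeed of E = E1 ∪ E2) to the involution block E1 (`stub_elim_gt`, landed)
and the END CASE "words ending in the letter `0`" — and registers that reduction as the stub
`elim_of_gt_of_end`.  Everything lives in the sub-namespace `OctaSpan.ElimEnd`.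

## What is proved

* §1 `toQ_ofTerms`, `toQ_shuffle` (`toQ (u ш v) = Σ_{w ∈ shuffleWord u v} [w]`), `sum_map_sym_mem_span`,
  `sum_map_sym_eq_count_smul_add`, `sym_mem_of_sum_mem` (isolating one word of a list sum over `ℚ`).
* §2 Combinatorics of `MZV.shuffleWord`: `append_mem_shuffleWord` (`u ++ v ∈ v ш u`),
  `cons_mem_shuffleWord_left/right`, `mem_shuffleWord_append_zero` (an interleaving of a `0`-free
  word `B` with `A ++ [0]` is `A ++ 0 :: B` or `w' ++ 0 :: B₂` with `B = B₁ ++ B₂`, `B₁ ≠ []`,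
  `w' ∈ B₁ ш A`), `exists_split_first/last`, `isConvergent_prefix_zero`, `isConvergent_tail`,
  `lowerSpan_congr`.
* §3 **`rel` is a shuffle ideal ⇒ decomposables are reducible**: `liftMap_sym`, `liftMap_mem_rel`,
  `shuffle_mem_of_reducible(')`: if `[X] ∈ rel ⊔ lowerSpan X` and `u` is convergent then
  `u ш X ∈ rel ⊔ span{[w]}`, `w` over the interleavings of `u` with the lower words (convergent, of
  length `|u| + |X|`, fewer than `#0(u) + #0(X)` letters `0`).
* §4 **The `p`-reduction** `elim_le_of_end_at` and the glue `elim_of_gt_of_end`: every convergent word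
  with a letter `0` reduces (E), given (E1) `#4 < #0 ⇒` reduces, and (End) every convergent word ENDING
  in `0` with `#0 ≤ #4` reduces whenever all shorter convergent words with a letter `0` do.  Proof: write
  `W = A ++ 0 :: B` with `B` `0`-free (`exists_split_last`); `[A0]` reduces at smaller length, so
  `B ш [A0] ∈ rel ⊔ lowerSpan W` (§3); `B ш A0 = [W] + Σ [w' 0 B₂]` over shorter `0`-free tails
  (§2), `[W]` is isolated over `ℚ` (§1); strong induction on `|B|`, then on the length.

## Evidence for the end case (worker's lab, exact linear algebra mod `p`; numbers, not a proof)

Single relation rows never peel E2 uniformly (405 of the 547 E2-words of length 5 have no one-letter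
finite-double-shuffle row whose other terms are lower; greedy peeling with all same-weight fds +
involution rows leaves 319/508 layer-`#0 = 1` words at length 5, 2650/2881 at length 6).  Modulo the
decomposables of §3, the layer-`c` parts of the single generators supported in `#0 ≤ c` have full rank
in every layer for lengths `≤ 6` (one-letter fds + involution), and in the layer `#0 = 1` for length 7
(where fds generators with `depth(l) = 2, 3` or the distribution are needed in addition: one-letter
fds + involution leave 23 of 4096); the layer `#0 = 1` modulo decomposables is the free module
`ℚ⟨1,2,3,4⟩_{w-1}` via `A 0 B ↦ (-1)^{|B|} rev(A) ш B`.

## Sources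

J. Zhao, *Standard relations of multiple polylogarithm values at roots of unity*, Doc. Math. 15
(2010), §2 (Lemma 2.2: products of iterated integrals are shuffles; the relation module is a shuffle
ideal) [Zhao2010]; C. Reutenauer, *Free Lie Algebras* (1993), §1.4 (shuffle recursion).  The rest is
folklore bookkeeping.
-/

noncomputable section

namespace Summit.KontsevichZagierPeriods.OctahedralSymmetry.OctaSpan.ElimEnd

open Literature.NumberTheory.Transcendental Literature.NumberTheory.Transcendental.LevelFour
open Summit.KontsevichZagierPeriods.FurushoPentagon.DoubleShuffleOfPentagon
  (perm_append_of_mem_shuffleWord count_of_mem_shuffleWord)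

/-! ## 1. Formal combinations: `toQ ∘ ofTerms`, shuffles as sums -/

/-- `toQ (ofTerms L) = Σ_{(c, V) ∈ L} c • [V]`. [folklore] -/
theorem toQ_ofTerms (L : List (ℤ × List (Fin 5))) :
    toQ (ofTerms L) = (L.map fun p => p.1 • sym p.2).sum := by
  induction L with
  | nil => simp
  | cons p L ih => rw [ofTerms_cons, map_add, toQ_single, ih, List.map_cons, List.sum_cons]

/-- `toQ (u ш v) = Σ_{w ∈ shuffleWord u v} [w]`. [folklore] -/
theorem toQ_shuffle (u v : List (Fin 5)) :
    toQ (shuffle u v) = ((MZV.shuffleWord u v).map sym).sum := by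
  rw [shuffle, toQ_ofTerms, List.map_map]
  congr 1
  exact List.map_congr_left fun w _ => by simp

/-- A sum `Σ_{w ∈ l} [w]` over words of a set `S` lies in the span of `[S]`. [folklore] -/
theorem sum_map_sym_mem_span {l : List (List (Fin 5))} {S : Set (List (Fin 5))}
    (h : ∀ w ∈ l, w ∈ S) : (l.map sym).sum ∈ Submodule.span ℚ (sym '' S) := by
  refine list_sum_mem fun x hx => ?_
  obtain ⟨w, hw, rfl⟩ := List.mem_map.1 hx
  exact Submodule.subset_span ⟨w, h w hw, rfl⟩

/-- Isolating one word of a list sum: `Σ_{w ∈ l} [w] = #a(l) • [a] + (a combination of the other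
words of `l`). [folklore] -/
theorem sum_map_sym_eq_count_smul_add (l : List (List (Fin 5))) (a : List (Fin 5)) :
    ∃ r ∈ Submodule.span ℚ (sym '' {b | b ∈ l ∧ b ≠ a}),
      (l.map sym).sum = (l.count a : ℚ) • sym a + r := by
  induction l with
  | nil => exact ⟨0, Submodule.zero_mem _, by simp⟩
  | cons b l ih =>
    obtain ⟨r, hr, hsum⟩ := ih
    have hmono : Submodule.span ℚ (sym '' {c | c ∈ l ∧ c ≠ a}) ≤
        Submodule.span ℚ (sym '' {c | c ∈ b :: l ∧ c ≠ a}) :=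
      Submodule.span_mono (Set.image_mono fun c ⟨hc, hca⟩ => ⟨List.mem_cons_of_mem b hc, hca⟩)
    by_cases hb : b = a
    · subst hb
      refine ⟨r, hmono hr, ?_⟩
      rw [List.map_cons, List.sum_cons, hsum, List.count_cons_self, Nat.cast_succ, add_smul, one_smul]
      abel
    · refine ⟨sym b + r, Submodule.add_mem _ (Submodule.subset_span ⟨b, ⟨List.mem_cons_self, hb⟩, rfl⟩)
        (hmono hr), ?_⟩
      rw [List.map_cons, List.sum_cons, hsum, List.count_cons_of_ne hb]
      abel

/-- If a list sum `Σ_{w ∈ l} [w]` lies in a submodule `N`, every word of `l` other than `a` has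
`[·] ∈ N`, and `a ∈ l`, then `[a] ∈ N` (over `ℚ`). [folklore] -/
theorem sym_mem_of_sum_mem {N : Submodule ℚ WordQ} {l : List (List (Fin 5))} {a : List (Fin 5)}
    (ha : a ∈ l) (hsum : (l.map sym).sum ∈ N) (hrest : ∀ b ∈ l, b ≠ a → sym b ∈ N) : sym a ∈ N := by
  obtain ⟨r, hr, heq⟩ := sum_map_sym_eq_count_smul_add l a
  have hrN : r ∈ N := by
    refine (Submodule.span_le.2 ?_) hr
    rintro _ ⟨b, ⟨hb, hba⟩, rfl⟩
    exact hrest b hb hba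
  have hca : (l.count a : ℚ) ≠ 0 := by
    have : 0 < l.count a := List.count_pos_iff.2 ha
    exact_mod_cast this.ne'
  have hsmul : (l.count a : ℚ) • sym a ∈ N := by
    have : (l.count a : ℚ) • sym a = (l.map sym).sum - r := by rw [heq]; abel
    rw [this]
    exact Submodule.sub_mem _ hsum hrN
  have := Submodule.smul_mem N ((l.count a : ℚ)⁻¹) hsmul
  rwa [smul_smul, inv_mul_cancel₀ hca, one_smul] at this

/-! ## 2. Combinatorics of `MZV.shuffleWord` -/

/-- `u ++ v` is one of the interleavings of `v` and `u` (all of `u` first). [folklore] -/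
theorem append_mem_shuffleWord {α : Type*} : ∀ (v u : List α), u ++ v ∈ MZV.shuffleWord v u
  | [], u => by simp
  | b :: v, [] => by simp
  | b :: v, a :: u => by
    rw [MZV.shuffleWord_cons_cons, List.mem_append]
    exact Or.inr (List.mem_map.2 ⟨u ++ b :: v, append_mem_shuffleWord (b :: v) u, rfl⟩)

/-- Prepending the first letter of the left factor: `w ∈ v ш u → b w ∈ (b v) ш u`. [folklore] -/
theorem cons_mem_shuffleWord_left {α : Type*} (b : α) {v u w : List α}
    (hw : w ∈ MZV.shuffleWord v u) : b :: w ∈ MZV.shuffleWord (b :: v) u := by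
  cases u with
  | nil =>
    simp only [MZV.shuffleWord_nil_right, List.mem_singleton] at hw ⊢
    rw [hw]
  | cons a u =>
    rw [MZV.shuffleWord_cons_cons, List.mem_append]
    exact Or.inl (List.mem_map.2 ⟨w, hw, rfl⟩)

/-- Prepending the first letter of the right factor: `w ∈ v ш u → a w ∈ v ш (a u)` for `v ≠ []`.
[folklore] -/
theorem cons_mem_shuffleWord_right {α : Type*} (a : α) {v u w : List α} (hv : v ≠ [])
    (hw : w ∈ MZV.shuffleWord v u) : a :: w ∈ MZV.shuffleWord v (a :: u) := by
  cases v with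
  | nil => exact (hv rfl).elim
  | cons b v =>
    rw [MZV.shuffleWord_cons_cons, List.mem_append]
    exact Or.inr (List.mem_map.2 ⟨w, hw, rfl⟩)

/-- **Interleavings with a word ending in `0`.** If `u = A ++ [0]` and `v` has no letter `0`, an
interleaving of `v` and `u` is either `u ++ v` (all of `u` first) or of the form `w' ++ 0 :: v₂` with
`v = v₁ ++ v₂`, `v₁ ≠ []` and `w'` an interleaving of `v₁` and `A`: the final `0` of `u` is followed
exactly by the letters of `v` not yet used. [folklore] -/
theorem mem_shuffleWord_append_zero : ∀ (v u : List (Fin 5)) {w : List (Fin 5)},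
    w ∈ MZV.shuffleWord v u → (0 : Fin 5) ∉ v → ∀ A : List (Fin 5), u = A ++ [0] →
      w = u ++ v ∨ ∃ v₁ v₂ w' : List (Fin 5), v = v₁ ++ v₂ ∧ v₁ ≠ [] ∧
        w' ∈ MZV.shuffleWord v₁ A ∧ w = w' ++ 0 :: v₂
  | [], u, w, hw, _, A, _ => by
    simp only [MZV.shuffleWord_nil_left, List.mem_singleton] at hw
    exact Or.inl (by rw [hw, List.append_nil])
  | b :: v, [], w, _, _, A, hu => by
    have := congrArg List.length hu
    simp at this
  | b :: v, a :: u, w, hw, hv, A, hu => by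
    simp only [MZV.shuffleWord_cons_cons, List.mem_append, List.mem_map] at hw
    rcases hw with ⟨w₂, hw₂, rfl⟩ | ⟨w₁, hw₁, rfl⟩
    · -- `w = b :: w₂`, `w₂` an interleaving of `v` and `u`
      have hv' : (0 : Fin 5) ∉ v := fun h => hv (List.mem_cons_of_mem b h)
      rcases mem_shuffleWord_append_zero v (a :: u) hw₂ hv' A hu with
        h | ⟨v₁, v₂, w', rfl, hne, hw', rfl⟩
      · refine Or.inr ⟨[b], v, b :: A, rfl, List.cons_ne_nil b [], ?_, ?_⟩
        · exact cons_mem_shuffleWord_left b (by simp)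
        · rw [h, hu]; simp
      · exact Or.inr ⟨b :: v₁, v₂, b :: w', rfl, List.cons_ne_nil b v₁,
          cons_mem_shuffleWord_left b hw', rfl⟩
    · -- `w = a :: w₁`, `w₁` an interleaving of `b :: v` and `u`
      cases A with
      | nil =>
        simp only [List.nil_append, List.cons.injEq] at hu
        obtain ⟨rfl, rfl⟩ := hu
        simp only [MZV.shuffleWord_nil_right, List.mem_singleton] at hw₁
        exact Or.inl (by rw [hw₁]; rfl)
      | cons a' A =>
        simp only [List.cons_append, List.cons.injEq] at hu
        obtain ⟨rfl, rfl⟩ := hu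
        rcases mem_shuffleWord_append_zero (b :: v) (A ++ [0]) hw₁ hv A rfl with
          h | ⟨v₁, v₂, w', hsplit, hne, hw', rfl⟩
        · exact Or.inl (by rw [h]; rfl)
        · exact Or.inr ⟨v₁, v₂, a :: w', hsplit, hne, cons_mem_shuffleWord_right a hne hw', rfl⟩

/-- First-occurrence split of a list at a letter. [folklore] -/
theorem exists_split_first {α : Type*} [DecidableEq α] (a : α) :
    ∀ {l : List α}, a ∈ l → ∃ s t : List α, l = s ++ a :: t ∧ a ∉ s
  | [], h => by simp at h
  | b :: l, h => by
    by_cases hb : b = a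
    · exact ⟨[], l, by rw [hb]; simp, by simp⟩
    · have h' : a ∈ l := by simpa [Ne.symm hb] using h
      obtain ⟨s, t, rfl, hs⟩ := exists_split_first a h'
      exact ⟨b :: s, t, rfl, by simp [Ne.symm hb, hs]⟩

/-- Last-occurrence split of a list at a letter. [folklore] -/
theorem exists_split_last {α : Type*} [DecidableEq α] (a : α) {l : List α} (h : a ∈ l) :
    ∃ s t : List α, l = s ++ a :: t ∧ a ∉ t := by
  obtain ⟨s, t, hl, hs⟩ := exists_split_first a (List.mem_reverse.2 h)
  refine ⟨t.reverse, s.reverse, ?_, by simpa using hs⟩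
  rw [← List.reverse_reverse l, hl]
  simp

/-- The word `A ++ [0]` in front of a `0`-free tail is convergent when the whole word is. [folklore] -/
theorem isConvergent_prefix_zero {A B : List (Fin 5)} (hW : IsConvergent (A ++ 0 :: B)) :
    IsConvergent (A ++ [0]) := by
  constructor
  · cases A with
    | nil => exact absurd rfl hW.1
    | cons a A => exact hW.1
  · simp

/-- The `0`-free tail `B ≠ []` of a convergent word `A ++ 0 :: B` is convergent. [folklore] -/
theorem isConvergent_tail {A B : List (Fin 5)} (hW : IsConvergent (A ++ 0 :: B))
    (hB : (0 : Fin 5) ∉ B) (hne : B ≠ []) : IsConvergent B := by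
  constructor
  · intro h
    exact hB (List.mem_of_mem_head? h)
  · intro h
    apply hW.2
    rw [List.getLast?_append, List.getLast?_cons, Option.some_or]
    cases B with
    | nil => exact (hne rfl).elim
    | cons b B =>
      rw [List.getLast?_eq_getLast_of_ne_nil (List.cons_ne_nil b B)] at h ⊢
      simpa using h

/-- `lowerSpan` only depends on the length and on `#0`. [folklore] -/
theorem lowerSpan_congr {V W : List (Fin 5)} (hlen : V.length = W.length)
    (h0 : V.count 0 = W.count 0) : lowerSpan V = lowerSpan W := by
  simp only [lowerSpan, hlen, h0]

/-! ## 3. `rel` is a shuffle ideal: products with a reducible factor are reducible -/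

/-- `liftMap u [V] = u ш V`. [folklore] -/
theorem liftMap_sym (u V : List (Fin 5)) : liftMap u (sym V) = toQ (shuffle u V) := by
  simp [liftMap, sym, Finsupp.linearCombination_single]

/-- `rel` is stable under the shuffle lift by a convergent word (the generators are, by `IsGen.lift`).
[cite: Zhao2010, §2 Lemma 2.2] -/
theorem liftMap_mem_rel {u : List (Fin 5)} (hu : IsConvergent u) {x : WordQ} (hx : x ∈ rel) :
    liftMap u x ∈ rel := by
  have h : Submodule.map (liftMap u) rel ≤ rel := by
    rw [rel, Submodule.map_span_le]
    exact fun ρ hρ => mem_rel_of_isGen (IsGen.lift hu hρ)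
  exact h (Submodule.mem_map_of_mem hx)

/-- **Decomposables are reducible.** If `[X]` reduces modulo `rel` to convergent words of the same
length with fewer letters `0`, then for every convergent word `u` the shuffle product `u ш X` lies in
`rel` plus the span of `[w]`, `w` ranging over the interleavings of `u` with such words `V` (all of
length `|u| + |X|`, convergent, with `#0(w) = #0(u) + #0(V) < #0(u) + #0(X)`); the target set `S` is
any set containing these interleavings. Mechanism: `rel` is stable under `u ш ·` (`liftMap`).
[cite: Zhao2010, §2 Lemma 2.2] -/
theorem shuffle_mem_of_reducible {u X : List (Fin 5)} (hu : IsConvergent u)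
    (hX : sym X ∈ rel ⊔ lowerSpan X) {S : Set (List (Fin 5))}
    (hS : ∀ V w : List (Fin 5), V.length = X.length → IsConvergent V → V.count 0 < X.count 0 →
      w ∈ MZV.shuffleWord u V → w ∈ S) :
    toQ (shuffle u X) ∈ rel ⊔ Submodule.span ℚ (sym '' S) := by
  obtain ⟨r, hr, l, hl, hsum⟩ := Submodule.mem_sup.1 hX
  rw [← liftMap_sym, ← hsum, map_add]
  refine Submodule.add_mem _ (Submodule.mem_sup_left (liftMap_mem_rel hu hr))
    (Submodule.mem_sup_right ?_)
  have key : Submodule.map (liftMap u) (lowerSpan X) ≤ Submodule.span ℚ (sym '' S) := by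
    rw [lowerSpan, Submodule.map_span_le]
    rintro _ ⟨V, ⟨hVlen, hVconv, hVlt⟩, rfl⟩
    rw [liftMap_sym, toQ_shuffle]
    exact sum_map_sym_mem_span fun w hw => hS V w hVlen hVconv hVlt hw
  exact key (Submodule.mem_map_of_mem hl)

/-- The natural instance of `shuffle_mem_of_reducible`: `u ш X` reduces to convergent words of length
`|u| + |X|` with fewer than `#0(u) + #0(X)` letters `0`. [cite: Zhao2010, §2 Lemma 2.2] -/
theorem shuffle_mem_of_reducible' {u X : List (Fin 5)} (hu : IsConvergent u)
    (hX : sym X ∈ rel ⊔ lowerSpan X) :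
    toQ (shuffle u X) ∈ rel ⊔ Submodule.span ℚ (sym '' {V | V.length = u.length + X.length ∧
      IsConvergent V ∧ V.count 0 < u.count 0 + X.count 0}) := by
  refine shuffle_mem_of_reducible hu hX fun V w hVlen hVconv hVlt hw => ⟨?_, ?_, ?_⟩
  · rw [MZV.length_of_mem_shuffleWord u V hw, hVlen]
  · exact isConvergent_of_mem_shuffleWord hu hVconv hw
  · rw [count_of_mem_shuffleWord hw]; omega


/-! ## 4. Reduction of E2 to words ending in `0` (the `p`-reduction) and the glue -/

/-- **The `p`-reduction at a fixed length `n`.** Assume E (every convergent word with a letter `0`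
reduces to fewer letters `0`) at all lengths `< n`, and assume the small block E2 at length `n` for the
words ENDING in `0`. Then E2 holds at length `n` for every word `A ++ 0 :: B` with a `0`-free tail `B`:
by strong induction on `|B|`, writing `[A0] ≡ lower` (length `< n`) and multiplying by the convergent
word `B` (`rel` is a shuffle ideal): `B ш [A0] = [A0B] + Σ [w' 0 B₂]` over proper tails `B₂` of `B`.
[folklore] -/
theorem elim_le_of_end_at {n : ℕ}
    (IHn : ∀ V : List (Fin 5), V.length < n → IsConvergent V → 0 < V.count 0 → sym V ∈ rel ⊔ lowerSpan V)
    (hEnd : ∀ W : List (Fin 5), W.length = n → IsConvergent W → W.getLast? = some 0 →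
      W.count 0 ≤ W.count 4 → sym W ∈ rel ⊔ lowerSpan W) :
    ∀ (k : ℕ) (A B : List (Fin 5)), B.length = k → (0 : Fin 5) ∉ B → (A ++ 0 :: B).length = n →
      IsConvergent (A ++ 0 :: B) → (A ++ 0 :: B).count 0 ≤ (A ++ 0 :: B).count 4 →
      sym (A ++ 0 :: B) ∈ rel ⊔ lowerSpan (A ++ 0 :: B) := by
  intro k
  induction k using Nat.strong_induction_on with
  | _ k ih =>
    intro A B hk hB hn hW h2
    by_cases hBnil : B = []
    · subst hBnil
      exact hEnd _ hn hW (by simp) h2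
    -- `W = u ++ B` with `u = A ++ [0]` reducible at length `< n`
    have hWu : A ++ 0 :: B = (A ++ [0]) ++ B := by simp
    have hu : IsConvergent (A ++ [0]) := isConvergent_prefix_zero hW
    have hBc : IsConvergent B := isConvergent_tail hW hB hBnil
    have hBpos : 0 < B.length := List.length_pos_iff.2 hBnil
    have hulen : (A ++ [0]).length < n := by
      rw [← hn]
      simp only [List.length_append, List.length_cons, List.length_nil]
      omega
    have hu0 : 0 < (A ++ [0]).count 0 := by simp
    have hured : sym (A ++ [0]) ∈ rel ⊔ lowerSpan (A ++ [0]) := IHn _ hulen hu hu0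
    -- the product `B ш u` lies in `rel ⊔ lowerSpan W`
    have hprod : toQ (shuffle B (A ++ [0])) ∈ rel ⊔ lowerSpan (A ++ 0 :: B) := by
      refine shuffle_mem_of_reducible hBc hured fun V w hVlen hVconv hVlt hw => ⟨?_, ?_, ?_⟩
      · rw [MZV.length_of_mem_shuffleWord B V hw, hVlen]
        simp only [List.length_append, List.length_cons, List.length_nil]
        omega
      · exact isConvergent_of_mem_shuffleWord hBc hVconv hw
      · rw [count_of_mem_shuffleWord hw, List.count_eq_zero.2 hB]
        simp only [List.count_append, List.count_cons_self, List.count_nil] at hVlt ⊢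
        omega
    rw [toQ_shuffle] at hprod
    -- isolate `[W]`: every other interleaving has a shorter `0`-free tail
    refine sym_mem_of_sum_mem (hWu ▸ append_mem_shuffleWord B (A ++ [0])) hprod fun w hw hne => ?_
    rcases mem_shuffleWord_append_zero B (A ++ [0]) hw hB A rfl with
      h | ⟨v₁, v₂, w', hsplit, hv₁, hw', rfl⟩
    · exact absurd (h.trans hWu.symm) hne
    · -- `w = w' ++ 0 :: v₂` with `|v₂| < |B|`: inner induction hypothesis
      have hv₂len : v₂.length < k := by
        rw [← hk, hsplit, List.length_append]
        exact Nat.lt_add_of_pos_left (List.length_pos_iff.2 hv₁)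
      have hv₂ : (0 : Fin 5) ∉ v₂ := fun h => hB (hsplit ▸ List.mem_append_right v₁ h)
      have hcount : ∀ a : Fin 5, (w' ++ 0 :: v₂).count a = (A ++ 0 :: B).count a := fun a => by
        rw [count_of_mem_shuffleWord hw a]
        simp only [List.count_append, List.count_cons, List.count_nil]
        omega
      have hlen : (w' ++ 0 :: v₂).length = n := by
        rw [← hn, MZV.length_of_mem_shuffleWord B (A ++ [0]) hw]
        simp only [List.length_append, List.length_cons, List.length_nil]
        omega
      have hconv : IsConvergent (w' ++ 0 :: v₂) := isConvergent_of_mem_shuffleWord hBc hu hw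
      have hle : (w' ++ 0 :: v₂).count 0 ≤ (w' ++ 0 :: v₂).count 4 := by
        rw [hcount 0, hcount 4]; exact h2
      have := ih _ hv₂len w' v₂ rfl hv₂ hlen hconv hle
      rwa [lowerSpan_congr (hlen.trans hn.symm) (hcount 0)] at this

/-- **E from E1 and the end case (all lengths) — the glue stub `elim_of_gt_of_end`.** If (E1) every
convergent word with more letters `0` than letters `4` reduces, and (End) every convergent word ENDING
in `0` with `#0 ≤ #4` reduces whenever all shorter convergent words with a letter `0` reduce, then every
convergent word with a letter `0` reduces (this is `elim_unitPole` of the skeleton; E2 in particular).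
Strong induction on the length, `elim_le_of_end_at` inside. [folklore] -/
theorem elim_of_gt_of_end
    (hE1 : ∀ V : List (Fin 5), IsConvergent V → V.count 4 < V.count 0 → sym V ∈ rel ⊔ lowerSpan V)
    (hEnd : ∀ W : List (Fin 5), (∀ V : List (Fin 5), V.length < W.length → IsConvergent V →
      0 < V.count 0 → sym V ∈ rel ⊔ lowerSpan V) → IsConvergent W → W.getLast? = some 0 →
      W.count 0 ≤ W.count 4 → sym W ∈ rel ⊔ lowerSpan W)
    (W : List (Fin 5)) (hW : IsConvergent W) (h1 : 0 < W.count 0) : sym W ∈ rel ⊔ lowerSpan W := by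
  suffices key : ∀ n : ℕ, ∀ W : List (Fin 5), W.length = n → IsConvergent W → 0 < W.count 0 →
      sym W ∈ rel ⊔ lowerSpan W from key _ W rfl hW h1
  intro n
  induction n using Nat.strong_induction_on with
  | _ n ihn =>
    intro W hn hW h1
    rcases lt_or_ge (W.count 4) (W.count 0) with hgt | hle
    · exact hE1 W hW hgt
    · have IHn : ∀ V : List (Fin 5), V.length < n → IsConvergent V → 0 < V.count 0 →
          sym V ∈ rel ⊔ lowerSpan V := fun V hV => ihn V.length (hn ▸ hV) V rfl
      obtain ⟨A, B, rfl, hB⟩ := exists_split_last (0 : Fin 5) (List.count_pos_iff.1 h1)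
      exact elim_le_of_end_at IHn (fun W' hW'n => hEnd W' (hW'n ▸ IHn)) B.length A B rfl hB hn hW hle

end Summit.KontsevichZagierPeriods.OctahedralSymmetry.OctaSpan.ElimEnd

end
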